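import Summits.AtomisticToContinuum.BoseEinsteinCondensation.Theses.BECStronglyRayleigh
import Summits.AtomisticToContinuum.BoseEinsteinCondensation.Theorems.InsertionFieldDelocalisation.Negative.Toolkit
import Summits.AtomisticToContinuum.BoseEinsteinCondensation.Theorems.InsertionFieldDelocalisation.Negative.Tightness
import HarnessLib

/-!
# Transfer: void tail + annealed gain ⇒ the size-biased third-moment bound
# (stub `stub_transfer` of line `mobile-trap-dirichlet-eigenfunction`, crux `InsertionFieldDelocalisation`,
# stmt-AtomisticToContinuum-9673)

Stub 6 of the skeleton `Cruxes/InsertionFieldDelocalisation` (line `mobile-trap-dirichlet-eigenfunction`).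
Conventions as in `Theorems/InsertionFieldDelocalisation/Negative/Toolkit.lean`: the two-particle insertion
field `r^T = field ψ T` (`|T| = N - 2`), `K1rhs r = Σ_x r_x²`; the void radius of `x` off `T` is
`ρ_T(x) = ((T.image fun t => dist x t).min.untopD 0)`, and `ν = N / L³`.

Claim (pure real analysis and finite-sum bookkeeping, no physics). Suppose, for every admissible datum,

* (void tail) `Σ_{(T,x) : R < ρ_T(x)} (r^T_x)² ≤ C₁ e^{-c₁ ν R³} Σ_{(T,x)} (r^T_x)²` for all `R`, with `c₁ > 0`;
* (annealed gain) `Σ_{ρ_T(x) = R} (r^T_x)² · (L³ r^T_x / Σ_y r^T_y) ≤ C₂ e^{c₂ ν R²} Σ_{ρ_T(x) = R} (r^T_x)²`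
  for all `R`.

Then `L³ Σ_T (Σ_x (r^T_x)³ / Σ_x r^T_x) ≤ M' Σ_T ‖r^T‖²` with one constant `M'`.

Proof. With the size-biased weights `W = r² ≥ 0` and `q = L³ r / Σ r`, the left-hand side is
`Σ_{(T,x)} W q` (pull `L³ / Σ_y r_y` out of the inner sum). Disintegrate by the shell `R = ρ_T(x)`
(`mt6tr_shell`): the annealed gain, shell by shell, gives `Σ W q ≤ C₂ Σ_{(T,x)} W · g(ρ)` with
`g(R) = e^{c₂ ν R²}` (after replacing `C₂, c₂` by their positive parts). Abel summation (`mt6tr_abel`):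
`g(ρ) = g(0) + Σ_{m < ρ} (g(m+1) - g(m))`, so
`Σ W g(ρ) = Σ W + Σ_m (g(m+1) - g(m)) Σ_{m < ρ} W ≤ (1 + Σ_m (g(m+1) - g(m)) C₁ e^{-c₁ ν m³}) Σ W`
by the void tail. The bracket is bounded uniformly in `ν ∈ [0, 1]` (`mt6tr_series_bound`): by convexity
`e^b - e^a ≤ (b - a) e^b`, the `m`-th term is at most `C₁ c₂ ν (2m+1) e^{c₂ν(m+1)² - c₁νm³}`; for
`m ≥ 8c₂/c₁ + 1` the exponent is `≤ -c₁νm³/2`, and `e^{-t} ≤ 1/(1+t)` gives the summable majorant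
`6 C₁ c₂ / (c₁ m²)`, while the finitely many small `m` contribute at most `C₁ e^{c₂ m₀²}` each.
-/

noncomputable section

namespace Summit.AtomisticToContinuum.BoseEinsteinCondensation.Cruxes.InsertionFieldDelocalisation.MobileTrapDirichletEigenfunction

open scoped BigOperators
open Literature.MathematicalPhysics.QuantumLattice Literature.Probability.LatticeModels
open Summit.AtomisticToContinuum.BoseEinsteinCondensation.Theorems.InsertionFieldDelocalisation.Negative
  (field K1rhs)

/-! ### Elementary exponential inequalities -/

/-- Convexity of the exponential: `e^b - e^a ≤ (b - a) e^b`. [folklore] -/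
theorem mt6tr_exp_sub_le (a b : ℝ) : Real.exp b - Real.exp a ≤ (b - a) * Real.exp b := by
  have h := Real.add_one_le_exp (a - b)
  have h2 : (a - b + 1) * Real.exp b ≤ Real.exp (a - b) * Real.exp b :=
    mul_le_mul_of_nonneg_right h (Real.exp_pos b).le
  rw [← Real.exp_add, sub_add_cancel] at h2
  nlinarith [h2]

/-- `e^{-t} ≤ 1 / (1 + t)` for `t ≥ 0`. [folklore] -/
theorem mt6tr_exp_neg_le (t : ℝ) (ht : 0 ≤ t) : Real.exp (-t) ≤ 1 / (1 + t) := by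
  rw [Real.exp_neg, ← one_div]
  exact one_div_le_one_div_of_le (by linarith) (by linarith [Real.add_one_le_exp t])

/-! ### The `ν`-uniform series bound -/

/-- Small shells: the `m`-th Abel term is at most `C₁ e^{c₂ m₀²}` for `m < m₀`, `ν ≤ 1`. [folklore] -/
theorem mt6tr_term_small (C₁ c₁ c₂ ν : ℝ) (m m₀ : ℕ) (hC₁ : 0 ≤ C₁) (hc₁ : 0 ≤ c₁) (hc₂ : 0 ≤ c₂)
    (hν0 : 0 ≤ ν) (hν1 : ν ≤ 1) (hm : m < m₀) :
    (Real.exp (c₂ * ν * ((m + 1 : ℕ) : ℝ) ^ 2) - Real.exp (c₂ * ν * (m : ℝ) ^ 2)) *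
        (C₁ * Real.exp (-(c₁ * ν * (m : ℝ) ^ 3))) ≤ C₁ * Real.exp (c₂ * (m₀ : ℝ) ^ 2) := by
  have h1 : Real.exp (c₂ * ν * ((m + 1 : ℕ) : ℝ) ^ 2) ≤ Real.exp (c₂ * (m₀ : ℝ) ^ 2) := by
    apply Real.exp_le_exp.mpr
    have hm1 : ((m + 1 : ℕ) : ℝ) ≤ (m₀ : ℝ) := by exact_mod_cast hm
    have hsq : ((m + 1 : ℕ) : ℝ) ^ 2 ≤ (m₀ : ℝ) ^ 2 := pow_le_pow_left₀ (Nat.cast_nonneg _) hm1 2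
    calc c₂ * ν * ((m + 1 : ℕ) : ℝ) ^ 2 ≤ c₂ * 1 * ((m + 1 : ℕ) : ℝ) ^ 2 :=
          mul_le_mul_of_nonneg_right (mul_le_mul_of_nonneg_left hν1 hc₂) (sq_nonneg _)
      _ ≤ c₂ * 1 * (m₀ : ℝ) ^ 2 := mul_le_mul_of_nonneg_left hsq (by rw [mul_one]; exact hc₂)
      _ = c₂ * (m₀ : ℝ) ^ 2 := by rw [mul_one]
  have h2 : Real.exp (c₂ * ν * ((m + 1 : ℕ) : ℝ) ^ 2) - Real.exp (c₂ * ν * (m : ℝ) ^ 2)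
      ≤ Real.exp (c₂ * (m₀ : ℝ) ^ 2) := by
    linarith [Real.exp_pos (c₂ * ν * (m : ℝ) ^ 2)]
  have h3 : C₁ * Real.exp (-(c₁ * ν * (m : ℝ) ^ 3)) ≤ C₁ := by
    have : Real.exp (-(c₁ * ν * (m : ℝ) ^ 3)) ≤ 1 :=
      Real.exp_le_one_iff.mpr (by rw [neg_nonpos]; positivity)
    calc C₁ * Real.exp (-(c₁ * ν * (m : ℝ) ^ 3)) ≤ C₁ * 1 := mul_le_mul_of_nonneg_left this hC₁
      _ = C₁ := mul_one _
  calc _ ≤ Real.exp (c₂ * (m₀ : ℝ) ^ 2) * C₁ :=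
        mul_le_mul h2 h3 (by positivity) (Real.exp_pos _).le
    _ = C₁ * Real.exp (c₂ * (m₀ : ℝ) ^ 2) := mul_comm _ _

/-- Large shells: for `m ≥ 8c₂/c₁ + 1` the `m`-th Abel term is at most `6 C₁ c₂ / (c₁ m²)`,
uniformly in `ν ≥ 0`. [folklore] -/
theorem mt6tr_term_large (C₁ c₁ c₂ ν : ℝ) (m : ℕ) (hC₁ : 0 ≤ C₁) (hc₁ : 0 < c₁) (hc₂ : 0 ≤ c₂)
    (hν0 : 0 ≤ ν) (hm : 8 * c₂ / c₁ + 1 ≤ (m : ℝ)) :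
    (Real.exp (c₂ * ν * ((m + 1 : ℕ) : ℝ) ^ 2) - Real.exp (c₂ * ν * (m : ℝ) ^ 2)) *
        (C₁ * Real.exp (-(c₁ * ν * (m : ℝ) ^ 3))) ≤ 6 * C₁ * c₂ / c₁ * (1 / (m : ℝ) ^ 2) := by
  have h80 : 0 ≤ 8 * c₂ / c₁ := by positivity
  have hm1 : (1 : ℝ) ≤ m := by linarith
  have hm0 : (0 : ℝ) < m := by linarith
  have hm8 : 8 * c₂ ≤ c₁ * m := by
    have h : 8 * c₂ / c₁ ≤ m := by linarith
    rw [div_le_iff₀ hc₁] at h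
    linarith
  have hcast : ((m + 1 : ℕ) : ℝ) = (m : ℝ) + 1 := by push_cast; ring
  rw [hcast]
  have hkey : c₂ * ((m : ℝ) + 1) ^ 2 ≤ c₁ / 2 * (m : ℝ) ^ 3 := by
    have h4 : ((m : ℝ) + 1) ^ 2 ≤ 4 * (m : ℝ) ^ 2 := by nlinarith
    calc c₂ * ((m : ℝ) + 1) ^ 2 ≤ c₂ * (4 * (m : ℝ) ^ 2) := mul_le_mul_of_nonneg_left h4 hc₂
      _ = 8 * c₂ * (m : ℝ) ^ 2 / 2 := by ring
      _ ≤ c₁ * m * (m : ℝ) ^ 2 / 2 := by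
          linarith [mul_le_mul_of_nonneg_right hm8 (sq_nonneg (m : ℝ))]
      _ = c₁ / 2 * (m : ℝ) ^ 3 := by ring
  have hτ0 : 0 ≤ c₁ / 2 * ν * (m : ℝ) ^ 3 := by positivity
  have hexp : Real.exp (c₂ * ν * ((m : ℝ) + 1) ^ 2) * Real.exp (-(c₁ * ν * (m : ℝ) ^ 3))
      ≤ Real.exp (-(c₁ / 2 * ν * (m : ℝ) ^ 3)) := by
    rw [← Real.exp_add]
    apply Real.exp_le_exp.mpr
    nlinarith [mul_le_mul_of_nonneg_left hkey hν0]
  have hd : Real.exp (c₂ * ν * ((m : ℝ) + 1) ^ 2) - Real.exp (c₂ * ν * (m : ℝ) ^ 2)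
      ≤ (c₂ * ν * ((m : ℝ) + 1) ^ 2 - c₂ * ν * (m : ℝ) ^ 2) *
          Real.exp (c₂ * ν * ((m : ℝ) + 1) ^ 2) :=
    mt6tr_exp_sub_le _ _
  have hm23 : (m : ℝ) ^ 2 ≤ (m : ℝ) ^ 3 := pow_le_pow_right₀ hm1 (by norm_num)
  calc (Real.exp (c₂ * ν * ((m : ℝ) + 1) ^ 2) - Real.exp (c₂ * ν * (m : ℝ) ^ 2))
        * (C₁ * Real.exp (-(c₁ * ν * (m : ℝ) ^ 3)))
      ≤ (c₂ * ν * ((m : ℝ) + 1) ^ 2 - c₂ * ν * (m : ℝ) ^ 2) *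
          Real.exp (c₂ * ν * ((m : ℝ) + 1) ^ 2) * (C₁ * Real.exp (-(c₁ * ν * (m : ℝ) ^ 3))) :=
        mul_le_mul_of_nonneg_right hd (by positivity)
    _ = C₁ * (c₂ * ν * (2 * m + 1))
        * (Real.exp (c₂ * ν * ((m : ℝ) + 1) ^ 2) * Real.exp (-(c₁ * ν * (m : ℝ) ^ 3))) := by ring
    _ ≤ C₁ * (c₂ * ν * (2 * m + 1)) * Real.exp (-(c₁ / 2 * ν * (m : ℝ) ^ 3)) :=
        mul_le_mul_of_nonneg_left hexp (by positivity)
    _ ≤ C₁ * (c₂ * ν * (2 * m + 1)) * (1 / (1 + c₁ / 2 * ν * (m : ℝ) ^ 3)) :=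
        mul_le_mul_of_nonneg_left (mt6tr_exp_neg_le _ hτ0) (by positivity)
    _ = C₁ * c₂ * ν * (2 * m + 1) / (1 + c₁ / 2 * ν * (m : ℝ) ^ 3) := by ring
    _ ≤ 6 * C₁ * c₂ / (c₁ * (m : ℝ) ^ 2) := by
        rw [div_le_div_iff₀ (by positivity) (by positivity)]
        have hP : 0 ≤ c₁ * C₁ * c₂ * ν := by positivity
        nlinarith [mul_le_mul_of_nonneg_left hm23 hP, mul_nonneg hC₁ hc₂]
    _ = 6 * C₁ * c₂ / c₁ * (1 / (m : ℝ) ^ 2) := by ring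

/-- **The `ν`-uniform series bound**: for `C₁, c₂ ≥ 0 < c₁` there is one `K` with
`Σ_{m<D} (e^{c₂ν(m+1)²} - e^{c₂νm²}) · C₁ e^{-c₁νm³} ≤ K` for all `ν ∈ [0, 1]` and all `D`. [folklore] -/
theorem mt6tr_series_bound (C₁ c₁ c₂ : ℝ) (hC₁ : 0 ≤ C₁) (hc₁ : 0 < c₁) (hc₂ : 0 ≤ c₂) :
    ∃ K : ℝ, ∀ ν : ℝ, 0 ≤ ν → ν ≤ 1 → ∀ D : ℕ,
      ∑ m ∈ Finset.range D, (Real.exp (c₂ * ν * ((m + 1 : ℕ) : ℝ) ^ 2)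
          - Real.exp (c₂ * ν * (m : ℝ) ^ 2)) * (C₁ * Real.exp (-(c₁ * ν * (m : ℝ) ^ 3))) ≤ K := by
  obtain ⟨m₀, hm₀⟩ := exists_nat_ge (8 * c₂ / c₁ + 1)
  obtain ⟨F, hF⟩ : ∃ F : ℕ → ℝ, F = fun m =>
      (if m < m₀ then C₁ * Real.exp (c₂ * (m₀ : ℝ) ^ 2) else 0)
        + 6 * C₁ * c₂ / c₁ * (1 / (m : ℝ) ^ 2) := ⟨_, rfl⟩
  have hF0 : ∀ m, 0 ≤ F m := fun m => by
    rw [hF]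
    dsimp only
    split_ifs <;> positivity
  have hFs : Summable F := by
    rw [hF]
    refine Summable.add ?_ ((Real.summable_one_div_nat_pow.mpr one_lt_two).mul_left _)
    refine summable_of_ne_finset_zero (s := Finset.range m₀) fun m hm => ?_
    exact if_neg fun h => hm (Finset.mem_range.mpr h)
  refine ⟨∑' m, F m, fun ν hν0 hν1 D => ?_⟩
  refine le_trans (Finset.sum_le_sum fun m _ => ?_)
    (hFs.sum_le_tsum (Finset.range D) fun m _ => hF0 m)
  rw [hF]
  dsimp only
  by_cases hm : m < m₀
  · rw [if_pos hm]
    have h1 := mt6tr_term_small C₁ c₁ c₂ ν m m₀ hC₁ hc₁.le hc₂ hν0 hν1 hm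
    have h2 : 0 ≤ 6 * C₁ * c₂ / c₁ * (1 / (m : ℝ) ^ 2) := by positivity
    linarith
  · rw [if_neg hm, zero_add]
    have hm' : 8 * c₂ / c₁ + 1 ≤ (m : ℝ) := hm₀.trans (by exact_mod_cast not_lt.mp hm)
    exact mt6tr_term_large C₁ c₁ c₂ ν m hC₁ hc₁ hc₂ hν0 hm'

/-! ### Shell disintegration and Abel summation over a finite index set -/

/-- **Shell disintegration**: a shell-by-shell bound `Σ_{ρ=R} W q ≤ G(R) Σ_{ρ=R} W` sums to
`Σ W q ≤ Σ G(ρ) W`. [folklore] -/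
theorem mt6tr_shell {ι : Type*} (s : Finset ι) (W q : ι → ℝ) (ρ : ι → ℕ) (G : ℕ → ℝ) (D : ℕ)
    (hD : ∀ i ∈ s, ρ i ≤ D)
    (hAG : ∀ R : ℕ, ∑ i ∈ s, (if ρ i = R then W i * q i else 0)
        ≤ G R * ∑ i ∈ s, (if ρ i = R then W i else 0)) :
    ∑ i ∈ s, W i * q i ≤ ∑ i ∈ s, G (ρ i) * W i := by
  have h1 : ∀ f : ι → ℝ, ∑ i ∈ s, f i
      = ∑ R ∈ Finset.range (D + 1), ∑ i ∈ s, (if ρ i = R then f i else 0) := by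
    intro f
    rw [Finset.sum_comm]
    refine Finset.sum_congr rfl fun i hi => ?_
    rw [Finset.sum_ite_eq, if_pos (Finset.mem_range.mpr (Nat.lt_succ_of_le (hD i hi)))]
  calc ∑ i ∈ s, W i * q i
      = ∑ R ∈ Finset.range (D + 1), ∑ i ∈ s, (if ρ i = R then W i * q i else 0) := h1 _
    _ ≤ ∑ R ∈ Finset.range (D + 1), ∑ i ∈ s, (if ρ i = R then G (ρ i) * W i else 0) := by
        refine Finset.sum_le_sum fun R _ => (hAG R).trans (le_of_eq ?_)
        rw [Finset.mul_sum]
        refine Finset.sum_congr rfl fun i _ => ?_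
        split_ifs with hR
        · rw [hR]
        · rw [mul_zero]
    _ = ∑ i ∈ s, G (ρ i) * W i := (h1 _).symm

/-- **Abel summation against a tail bound**: for `g` monotone and
`Σ_{m < ρ} W ≤ h(m) Σ W` for all `m`,
`Σ g(ρ) W ≤ (g 0 + Σ_{m<D} (g(m+1) - g(m)) h(m)) Σ W` whenever `ρ ≤ D`. [folklore] -/
theorem mt6tr_abel {ι : Type*} (s : Finset ι) (W : ι → ℝ) (ρ : ι → ℕ) (g h : ℕ → ℝ) (D : ℕ)
    (hD : ∀ i ∈ s, ρ i ≤ D) (hg : Monotone g)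
    (htail : ∀ m : ℕ, ∑ i ∈ s, (if m < ρ i then W i else 0) ≤ h m * ∑ i ∈ s, W i) :
    ∑ i ∈ s, g (ρ i) * W i
      ≤ (g 0 + ∑ m ∈ Finset.range D, (g (m + 1) - g m) * h m) * ∑ i ∈ s, W i := by
  have htel : ∀ i ∈ s, g (ρ i) * W i
      = g 0 * W i + ∑ m ∈ Finset.range D, (g (m + 1) - g m) * (if m < ρ i then W i else 0) := by
    intro i hi
    have hf : (Finset.range D).filter (fun m => m < ρ i) = Finset.range (ρ i) := by
      ext m
      simp only [Finset.mem_filter, Finset.mem_range]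
      exact ⟨fun hm => hm.2, fun hm => ⟨lt_of_lt_of_le hm (hD i hi), hm⟩⟩
    have h1 : ∑ m ∈ Finset.range D, (g (m + 1) - g m) * (if m < ρ i then W i else 0)
        = (∑ m ∈ Finset.range (ρ i), (g (m + 1) - g m)) * W i := by
      rw [← hf, Finset.sum_filter, Finset.sum_mul]
      refine Finset.sum_congr rfl fun m _ => ?_
      split_ifs <;> simp
    rw [h1, Finset.sum_range_sub]
    ring
  have hsum : ∑ i ∈ s, g (ρ i) * W i = g 0 * ∑ i ∈ s, W i
      + ∑ m ∈ Finset.range D, (g (m + 1) - g m) * ∑ i ∈ s, (if m < ρ i then W i else 0) := by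
    rw [Finset.sum_congr rfl htel, Finset.sum_add_distrib, Finset.sum_comm]
    simp only [Finset.mul_sum]
  rw [hsum, add_mul, Finset.sum_mul]
  refine add_le_add le_rfl (Finset.sum_le_sum fun m _ => ?_)
  rw [mul_assoc]
  exact mul_le_mul_of_nonneg_left (htail m) (sub_nonneg.mpr (hg (Nat.le_succ m)))

/-! ### The transfer, abstract form -/

/-- **Transfer, abstract form**: on a finite family `s` of trap sets `T` with fields `r T : β → ℝ`,
void radii `ρ T x`, a void-tail bound and a shell-wise annealed-gain bound imply
`Λ Σ_T (Σ_x r³ / Σ_x r) ≤ C₂⁺ (1 + K) Σ_T Σ_x r²`, where `K` bounds the Abel series. [folklore] -/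
theorem mt6tr_core {α β : Type*} [Fintype β] (s : Finset α) (r : α → β → ℝ) (ρ : α → β → ℕ)
    (Λ C₁ c₁ C₂ c₂ ν K : ℝ) (hν0 : 0 ≤ ν)
    (hVT : ∀ R : ℕ, ∑ T ∈ s, ∑ x, (if R < ρ T x then r T x ^ 2 else 0)
        ≤ C₁ * Real.exp (-(c₁ * ν * (R : ℝ) ^ 3)) * ∑ T ∈ s, ∑ x, r T x ^ 2)
    (hAG : ∀ R : ℕ, ∑ T ∈ s, ∑ x, (if ρ T x = R then r T x ^ 2 * (Λ * r T x / ∑ y, r T y) else 0)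
        ≤ C₂ * Real.exp (c₂ * ν * (R : ℝ) ^ 2) * ∑ T ∈ s, ∑ x, (if ρ T x = R then r T x ^ 2 else 0))
    (hK : ∀ D : ℕ, ∑ m ∈ Finset.range D, (Real.exp (max c₂ 0 * ν * ((m + 1 : ℕ) : ℝ) ^ 2)
        - Real.exp (max c₂ 0 * ν * (m : ℝ) ^ 2)) * (max C₁ 0 * Real.exp (-(c₁ * ν * (m : ℝ) ^ 3)))
          ≤ K) :
    Λ * ∑ T ∈ s, (∑ x, r T x ^ 3) / (∑ x, r T x) ≤ max C₂ 0 * (1 + K) * ∑ T ∈ s, ∑ x, r T x ^ 2 := by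
  classical
  set S : Finset (α × β) := s ×ˢ Finset.univ
  set W : α × β → ℝ := fun p => r p.1 p.2 ^ 2
  set q : α × β → ℝ := fun p => Λ * r p.1 p.2 / ∑ y, r p.1 y
  set ρ' : α × β → ℕ := fun p => ρ p.1 p.2
  set g : ℕ → ℝ := fun R => Real.exp (max c₂ 0 * ν * (R : ℝ) ^ 2)
  set h : ℕ → ℝ := fun m => max C₁ 0 * Real.exp (-(c₁ * ν * (m : ℝ) ^ 3))
  set D : ℕ := S.sup ρ'
  have hD : ∀ p ∈ S, ρ' p ≤ D := fun p hp => Finset.le_sup hp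
  have hWnn : ∀ p, 0 ≤ W p := fun p => sq_nonneg _
  have hsumW : ∑ p ∈ S, W p = ∑ T ∈ s, ∑ x, r T x ^ 2 := by
    simp only [S, W, Finset.sum_product]
  have hW0 : 0 ≤ ∑ p ∈ S, W p := Finset.sum_nonneg fun p _ => hWnn p
  have hVT1 : ∀ m : ℕ, ∑ p ∈ S, (if m < ρ' p then W p else 0) ≤ h m * ∑ p ∈ S, W p := by
    intro m
    have h1 : ∑ p ∈ S, (if m < ρ' p then W p else 0)
        ≤ C₁ * Real.exp (-(c₁ * ν * (m : ℝ) ^ 3)) * ∑ p ∈ S, W p := by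
      simpa only [S, W, ρ', Finset.sum_product] using hVT m
    exact h1.trans (mul_le_mul_of_nonneg_right
      (mul_le_mul_of_nonneg_right (le_max_left _ _) (Real.exp_pos _).le) hW0)
  have hAG1 : ∀ R : ℕ, ∑ p ∈ S, (if ρ' p = R then W p * q p else 0)
      ≤ (max C₂ 0 * g R) * ∑ p ∈ S, (if ρ' p = R then W p else 0) := by
    intro R
    have hP : 0 ≤ ∑ p ∈ S, (if ρ' p = R then W p else 0) :=
      Finset.sum_nonneg fun p _ => by split_ifs; exacts [hWnn p, le_rfl]
    have h1 : ∑ p ∈ S, (if ρ' p = R then W p * q p else 0)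
        ≤ C₂ * Real.exp (c₂ * ν * (R : ℝ) ^ 2) * ∑ p ∈ S, (if ρ' p = R then W p else 0) := by
      simpa only [S, W, q, ρ', Finset.sum_product] using hAG R
    refine h1.trans (mul_le_mul_of_nonneg_right ?_ hP)
    calc C₂ * Real.exp (c₂ * ν * (R : ℝ) ^ 2) ≤ max C₂ 0 * Real.exp (c₂ * ν * (R : ℝ) ^ 2) :=
          mul_le_mul_of_nonneg_right (le_max_left _ _) (Real.exp_pos _).le
      _ ≤ max C₂ 0 * g R := mul_le_mul_of_nonneg_left (Real.exp_le_exp.mpr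
          (mul_le_mul_of_nonneg_right (mul_le_mul_of_nonneg_right (le_max_left _ _) hν0)
            (sq_nonneg _))) (le_max_right _ _)
  have hgm : Monotone g := by
    intro a b hab
    apply Real.exp_le_exp.mpr
    have hab' : (a : ℝ) ^ 2 ≤ (b : ℝ) ^ 2 :=
      pow_le_pow_left₀ (Nat.cast_nonneg a) (Nat.cast_le.mpr hab) 2
    exact mul_le_mul_of_nonneg_left hab' (mul_nonneg (le_max_right _ _) hν0)
  have hg0 : g 0 = 1 := by simp [g]
  have hB := mt6tr_shell S W q ρ' (fun R => max C₂ 0 * g R) D hD hAG1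
  have hA := mt6tr_abel S W ρ' g h D hD hgm hVT1
  have hLHS : Λ * ∑ T ∈ s, (∑ x, r T x ^ 3) / (∑ x, r T x) = ∑ p ∈ S, W p * q p := by
    simp only [S, W, q, Finset.sum_product]
    rw [Finset.mul_sum]
    refine Finset.sum_congr rfl fun T _ => ?_
    rw [Finset.sum_div, Finset.mul_sum]
    refine Finset.sum_congr rfl fun x _ => ?_
    ring
  calc Λ * ∑ T ∈ s, (∑ x, r T x ^ 3) / (∑ x, r T x) = ∑ p ∈ S, W p * q p := hLHS
    _ ≤ ∑ p ∈ S, (max C₂ 0 * g (ρ' p)) * W p := hB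
    _ = max C₂ 0 * ∑ p ∈ S, g (ρ' p) * W p := by
        rw [Finset.mul_sum]
        exact Finset.sum_congr rfl fun p _ => mul_assoc _ _ _
    _ ≤ max C₂ 0 * ((g 0 + ∑ m ∈ Finset.range D, (g (m + 1) - g m) * h m) * ∑ p ∈ S, W p) :=
        mul_le_mul_of_nonneg_left hA (le_max_right _ _)
    _ ≤ max C₂ 0 * ((1 + K) * ∑ p ∈ S, W p) := by
        refine mul_le_mul_of_nonneg_left (mul_le_mul_of_nonneg_right ?_ hW0) (le_max_right _ _)
        rw [hg0]
        exact add_le_add le_rfl (hK D)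
    _ = max C₂ 0 * (1 + K) * ∑ T ∈ s, ∑ x, r T x ^ 2 := by rw [hsumW, mul_assoc]

/-! ### The registered stub -/

/-- STUB 6 · `stub_transfer` — **void tail ⇒ annealed gain ⇒ the crux in its size-biased
third-moment form** `L³ Σ_T (Σ_x (r^T_x)³ / Σ_x r^T_x) ≤ M' Σ_T ‖r^T‖²`: shell disintegration by the
void radius, Abel summation, and a series bound uniform in `ν = N/L³ ∈ (0, ½]`. [folklore] -/
theorem stub_transfer :
    (∃ C₁ c₁ : ℝ, 0 < c₁ ∧ ∀ (L : ℕ) [NeZero L], 2 ≤ L → ∀ N : ℕ, 2 ≤ N → 2 * N ≤ L ^ 3 →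
      ∀ ψ : TensorIndex (TorusSite 3 L) 2 → ℂ,
        ψ ∈ spinZSector 1 ((N : ℝ) - (L : ℝ) ^ 3 / 2) → ψ ≠ 0 →
        (xyTorus 3 L 1).mulVec ψ =
          ((lowestEnergyInSector 1 (xyTorus 3 L 1) ((N : ℝ) - (L : ℝ) ^ 3 / 2) : ℝ) : ℂ) • ψ →
        (∀ σ, 0 ≤ (ψ σ).re ∧ (ψ σ).im = 0) → ∀ R : ℕ,
        (∑ T ∈ (Finset.univ : Finset (TorusSite 3 L)).powersetCard (N - 2), ∑ x : TorusSite 3 L,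
            if R < ((T.image fun t => (torusGraph 3 L).dist x t).min.untopD 0) then field ψ T x ^ 2 else 0)
          ≤ C₁ * Real.exp (-(c₁ * ((N : ℝ) / (L : ℝ) ^ 3) * (R : ℝ) ^ 3)) *
            ∑ T ∈ (Finset.univ : Finset (TorusSite 3 L)).powersetCard (N - 2), ∑ x : TorusSite 3 L,
              field ψ T x ^ 2) →
    (∃ C₂ c₂ : ℝ, ∀ (L : ℕ) [NeZero L], 2 ≤ L → ∀ N : ℕ, 2 ≤ N → 2 * N ≤ L ^ 3 →
      ∀ ψ : TensorIndex (TorusSite 3 L) 2 → ℂ,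
        ψ ∈ spinZSector 1 ((N : ℝ) - (L : ℝ) ^ 3 / 2) → ψ ≠ 0 →
        (xyTorus 3 L 1).mulVec ψ =
          ((lowestEnergyInSector 1 (xyTorus 3 L 1) ((N : ℝ) - (L : ℝ) ^ 3 / 2) : ℝ) : ℂ) • ψ →
        (∀ σ, 0 ≤ (ψ σ).re ∧ (ψ σ).im = 0) → ∀ R : ℕ,
        (∑ T ∈ (Finset.univ : Finset (TorusSite 3 L)).powersetCard (N - 2), ∑ x : TorusSite 3 L,
            if ((T.image fun t => (torusGraph 3 L).dist x t).min.untopD 0) = R then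
              field ψ T x ^ 2 * ((L : ℝ) ^ 3 * field ψ T x / ∑ y : TorusSite 3 L, field ψ T y)
            else 0)
          ≤ C₂ * Real.exp (c₂ * ((N : ℝ) / (L : ℝ) ^ 3) * (R : ℝ) ^ 2) *
            ∑ T ∈ (Finset.univ : Finset (TorusSite 3 L)).powersetCard (N - 2), ∑ x : TorusSite 3 L,
              if ((T.image fun t => (torusGraph 3 L).dist x t).min.untopD 0) = R then field ψ T x ^ 2 else 0) →
    ∃ M' : ℝ, ∀ (L : ℕ) [NeZero L], 2 ≤ L → ∀ N : ℕ, 2 ≤ N → 2 * N ≤ L ^ 3 →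
      ∀ ψ : TensorIndex (TorusSite 3 L) 2 → ℂ,
        ψ ∈ spinZSector 1 ((N : ℝ) - (L : ℝ) ^ 3 / 2) → ψ ≠ 0 →
        (xyTorus 3 L 1).mulVec ψ =
          ((lowestEnergyInSector 1 (xyTorus 3 L 1) ((N : ℝ) - (L : ℝ) ^ 3 / 2) : ℝ) : ℂ) • ψ →
        (∀ σ, 0 ≤ (ψ σ).re ∧ (ψ σ).im = 0) →
        (L : ℝ) ^ 3 * ∑ T ∈ (Finset.univ : Finset (TorusSite 3 L)).powersetCard (N - 2),
            (∑ x, field ψ T x ^ 3) / (∑ x, field ψ T x)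
          ≤ M' * ∑ T ∈ (Finset.univ : Finset (TorusSite 3 L)).powersetCard (N - 2), K1rhs (field ψ T) := by
  rintro ⟨C₁, c₁, hc₁, hVT⟩ ⟨C₂, c₂, hAG⟩
  obtain ⟨K, hK⟩ :=
    mt6tr_series_bound (max C₁ 0) c₁ (max c₂ 0) (le_max_right _ _) hc₁ (le_max_right _ _)
  refine ⟨max C₂ 0 * (1 + K), ?_⟩
  intro L _ hL N hN hNL ψ hψ hne heig hnn
  have hLpos : (0 : ℝ) < (L : ℝ) := by exact_mod_cast (by omega : 0 < L)
  have hL3 : (0 : ℝ) < (L : ℝ) ^ 3 := pow_pos hLpos 3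
  have hν0 : (0 : ℝ) ≤ (N : ℝ) / (L : ℝ) ^ 3 := by positivity
  have hν1 : (N : ℝ) / (L : ℝ) ^ 3 ≤ 1 := by
    rw [div_le_one hL3]
    have h : (N : ℝ) ≤ ((L ^ 3 : ℕ) : ℝ) := by exact_mod_cast (by omega : N ≤ L ^ 3)
    simpa using h
  have key := mt6tr_core ((Finset.univ : Finset (TorusSite 3 L)).powersetCard (N - 2)) (field ψ)
    (fun T x => ((T.image fun t => (torusGraph 3 L).dist x t).min.untopD 0))
    ((L : ℝ) ^ 3) C₁ c₁ C₂ c₂ ((N : ℝ) / (L : ℝ) ^ 3) K hν0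
    (fun R => hVT L hL N hN hNL ψ hψ hne heig hnn R)
    (fun R => hAG L hL N hN hNL ψ hψ hne heig hnn R)
    (fun D => hK _ hν0 hν1 D)
  unfold K1rhs
  exact key

end Summit.AtomisticToContinuum.BoseEinsteinCondensation.Cruxes.InsertionFieldDelocalisation.MobileTrapDirichletEigenfunction

end
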